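import Summits.HubbardSuperconductivity.HubbardSuperconductivity.Theses.JosephsonMirror

/-!
# Sketch — first lemmas of the crux idea cards for `JmInterchange` (ideator 2, round 1)

Statements only (`sorry` bodies); they must elaborate over existing declarations.

* `floorCapture_of_sectorGap` — card `kt-scale-isolation-pinch`: the Horsch–von der Linden / Koma–Tasaki
  double-commutator moment pinches the pair-removed floor vector `Δ_d φ₀` onto the `(N-2)`-floor as soon
  as that floor is isolated by `γ` inside its sector: `‖P_{G(N-2)} Δ_d φ₀‖² ≥ ‖Δ_d φ₀‖² - ⟨φ₀,[Δ_d†,[H,Δ_d]]φ₀⟩/γ`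
  (given local pair-convexity of the sector energies at `N`).
* `doubleComm_pairField_rayleigh_le` — the locality input: `⟨φ,[Δ_d†,[H,Δ_d]]φ⟩ ≤ C(U)·L²`.
* `gain_le_firstOrder_add_secondOrder` — card `kt-scale-isolation-pinch`, rate form: abstract second-order
  floor lock for `H₀ - J K` under a gap.
* `ker_invariant_of_eulerLagrange` — card `pair-transfer-support-theorem`: Lieb-style kernel invariance
  for the Euler–Lagrange system of the mirror's PSD minimiser.
-/

set_option linter.dupNamespace false

namespace Summit.HubbardSuperconductivity.HubbardSuperconductivity.Cruxes.JmInterchange.SketchIdeator2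

open Matrix Literature.MathematicalPhysics.QuantumLattice
open scoped ComplexOrder

/-- KT pinch (card `kt-scale-isolation-pinch`, first lemma). `H = hubbardTorus 2 L 1 U`,
`Δ = pairField dWaveFormFactor L`, `e n = minEnergyOn H (szSector n 0)`, and the BALANCED layer
`A = hubbardTorusWith 2 L 1 U μ_L`, `μ_L = (e N - e (N-2))/2` (so that `φ`, `Δ φ` sit at the same `A`-floor
`e′`; the Koma–Tasaki moment identity is `⟨φ,[Δᴴ,[A,Δ]]φ⟩ = ⟨Δφ,(A-e′)Δφ⟩ + ⟨Δᴴφ,(A-e′)Δᴴφ⟩`, both terms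
`≥ 0` under local pair-convexity). If the `(N-2, S^z=0)` floor is isolated by `γ` within its sector, some
unit ground state `χ` of `(N-2,0)` captures all of `Δ φ₀` but `⟨φ₀,[Δᴴ,[A,Δ]]φ₀⟩/γ`. -/
theorem floorCapture_of_sectorGap (L : ℕ) [NeZero L] (U γ : ℝ) (N : ℕ) (hγ : 0 < γ)
    (hconv : 2 * (hubbardTorus 2 L 1 U).minEnergyOn (szSector N 0) ≤
      (hubbardTorus 2 L 1 U).minEnergyOn (szSector (N + 2) 0) +
        (hubbardTorus 2 L 1 U).minEnergyOn (szSector (N - 2) 0))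
    (hne : ∃ χ, IsGroundStateInSector (hubbardTorus 2 L 1 U) (N - 2) 0 χ)
    (hgap : ∀ v : Fock (Orb (FermionTorus 2 L)), v ∈ szSector (N - 2) 0 → star v ⬝ᵥ v = 1 →
      (∀ χ, IsGroundStateInSector (hubbardTorus 2 L 1 U) (N - 2) 0 χ → star χ ⬝ᵥ v = 0) →
        (hubbardTorus 2 L 1 U).minEnergyOn (szSector (N - 2) 0) + γ ≤
          (star v ⬝ᵥ (hubbardTorus 2 L 1 U) *ᵥ v).re)
    (φ : Fock (Orb (FermionTorus 2 L)))
    (hφ : IsGroundStateInSector (hubbardTorus 2 L 1 U) N 0 φ) (h1 : star φ ⬝ᵥ φ = 1) :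
    let μ : ℝ := ((hubbardTorus 2 L 1 U).minEnergyOn (szSector N 0) -
        (hubbardTorus 2 L 1 U).minEnergyOn (szSector (N - 2) 0)) / 2
    let A := hubbardTorusWith 2 L 1 U μ
    let Δ := pairField dWaveFormFactor L
    ∃ χ : Fock (Orb (FermionTorus 2 L)),
      IsGroundStateInSector (hubbardTorus 2 L 1 U) (N - 2) 0 χ ∧ star χ ⬝ᵥ χ = 1 ∧
        (star (Δ *ᵥ φ) ⬝ᵥ (Δ *ᵥ φ)).re -
            (star φ ⬝ᵥ ((Δᴴ * (A * Δ - Δ * A) - (A * Δ - Δ * A) * Δᴴ) *ᵥ φ)).re / γ ≤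
          ‖star χ ⬝ᵥ (Δ *ᵥ φ)‖ ^ 2 := by
  sorry

/-- Locality input (card `kt-scale-isolation-pinch`): the double commutator `[Δ_dᴴ,[A,Δ_d]]`
(`A = hubbardTorusWith 2 L 1 U μ`; the `μ`-part is the one-body operator `2μ[Δ_dᴴ,Δ_d]`) is a sum of
`O(L²)` bounded local terms, hence its Rayleigh quotients are `≤ C(U,μ)·L²` (the constant is a placeholder to
be fixed by the prover; KT 1994 (2.9): `c₀ = 2r²h μ⁻²`). -/
theorem doubleComm_pairField_rayleigh_le (L : ℕ) [NeZero L] (U μ : ℝ)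
    (φ : Fock (Orb (FermionTorus 2 L))) (h1 : star φ ⬝ᵥ φ = 1) :
    let A := hubbardTorusWith 2 L 1 U μ
    let Δ := pairField dWaveFormFactor L
    (star φ ⬝ᵥ ((Δᴴ * (A * Δ - Δ * A) - (A * Δ - Δ * A) * Δᴴ) *ᵥ φ)).re ≤
      (2048 * (1 + |U| + |μ|)) * (L : ℝ) ^ 2 := by
  sorry

/-- Rate form (card `kt-scale-isolation-pinch`): abstract second-order floor lock. `H₀` Hermitian with
ground energy `E₀ = minEnergyOn H₀ ⊤`, `K` Hermitian with Rayleigh quotients bounded by `k`, a gap `γ`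
above the ground space, and a weak coupling `4 J k ≤ γ`: the gain of `H₀ - J K` exceeds the first-order
(floor) response by at most `2 J² k² / γ`. -/
theorem gain_le_firstOrder_add_secondOrder {n : Type*} [Fintype n] [DecidableEq n] [Nonempty n]
    (H₀ K : Matrix n n ℂ) (hH : H₀.IsHermitian) (hK : K.IsHermitian) (J k γ κ : ℝ)
    (hJ : 0 ≤ J) (hk : ∀ v : n → ℂ, star v ⬝ᵥ v = 1 → |(star v ⬝ᵥ K *ᵥ v).re| ≤ k)
    (hγ : 0 < γ)
    (hgap : ∀ v : n → ℂ, star v ⬝ᵥ v = 1 →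
      (∀ ψ : n → ℂ, H₀ *ᵥ ψ = ((H₀.minEnergyOn ⊤ : ℝ) : ℂ) • ψ → star ψ ⬝ᵥ v = 0) →
        H₀.minEnergyOn ⊤ + γ ≤ (star v ⬝ᵥ H₀ *ᵥ v).re)
    (hκ : ∀ ψ : n → ℂ, H₀ *ᵥ ψ = ((H₀.minEnergyOn ⊤ : ℝ) : ℂ) • ψ → star ψ ⬝ᵥ ψ = 1 →
      (star ψ ⬝ᵥ K *ᵥ ψ).re ≤ κ)
    (hweak : 4 * J * k ≤ γ) :
    H₀.minEnergyOn ⊤ - (H₀ - (J : ℂ) • K).minEnergyOn ⊤ ≤ J * κ + 2 * J ^ 2 * k ^ 2 / γ := by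
  sorry

/-- Support theorem (card `pair-transfer-support-theorem`, first lemma): Lieb-1989-style kernel
invariance for the Euler–Lagrange system of the window double's PSD minimiser `W = W₁ ⊕ W₂`
(`A₁, A₂` the two balanced sector blocks, `D` the pair-removal block, gain `lam`, coupling `J ≠ 0`):
the kernel of `W₁` is mapped by `D` into the kernel of `W₂` and is `A₁`-invariant. -/
theorem ker_invariant_of_eulerLagrange {m n : Type*} [Fintype m] [Fintype n] [DecidableEq m]
    [DecidableEq n] (A₁ : Matrix n n ℂ) (A₂ : Matrix m m ℂ) (D : Matrix m n ℂ)
    (W₁ : Matrix n n ℂ) (W₂ : Matrix m m ℂ) (hA₁ : A₁.IsHermitian) (hA₂ : A₂.IsHermitian)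
    (hW₁ : W₁.PosSemidef) (hW₂ : W₂.PosSemidef) (J lam : ℝ) (hJ : J ≠ 0)
    (hEL₁ : A₁ * W₁ + W₁ * A₁ - (J : ℂ) • (Dᴴ * W₂ * D) = -((lam : ℂ) • W₁))
    (hEL₂ : A₂ * W₂ + W₂ * A₂ - (J : ℂ) • (D * W₁ * Dᴴ) = -((lam : ℂ) • W₂))
    (x : n → ℂ) (hx : W₁ *ᵥ x = 0) :
    W₂ *ᵥ (D *ᵥ x) = 0 ∧ W₁ *ᵥ (A₁ *ᵥ x) = 0 := by
  sorry

end Summit.HubbardSuperconductivity.HubbardSuperconductivity.Cruxes.JmInterchange.SketchIdeator2
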